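import Summits.Ventures.Crystal3D.Theorems.StickyWulffConstantCoaxialWallLawSeamEndBallRigidity
import Summits.Ventures.Crystal3D.Theorems.StickyWulffConstantGenericWallFloorSlotTriples
import Summits.Ventures.Crystal3D.Theorems.StickyWulffConstantGenericWallFloorStarLemma
import Literature.Geometry.DiscreteGeometry.KissingRigidity
import HarnessLib

/-!
# VACANCY CENSUS: around a vacant slot of an otherwise complete slot dozen, two neighbours are unsaturated — from KissingGap and ONE
# cap-packing certificate (crux `CoaxialWallLaw`, stmt-Ventures-19481; lane F 'Certificates' v8.3, registered stub `stub_threePayer`)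

HONEST FRAMING. Venture `Summits/Ventures/Crystal3D` (cell `crystal3d-full`); helper for `stub_threePayer` (line of record
`threePayer_of_census stub_satCensus11 stub_satCensus12`, '…SeamEndBallRigidity').  Seat 19481-p2 g14 found (kit j335321/j335367) that 11-point
`5/4`-gap shells are NOT classified (exotic, flexible ones abound, even around a pinned lattice star), so `SatCensus11` has no shell-level certificate;
but its VACANCY regime — the contact shell of `b` is a complete slot dozen `{b + A w}` minus ONE slot `s₀` (the shape forced at FULL-reader (A)-ends by
E1 in 16 of the 85 multi-twin rows of the seat's exact enumeration) — reduces to KissingGap (5/2) and ONE finite-dimensional cap-packing statement: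
* **`VacancyCapFcc`** (named, certificate-shaped; kit j335336 `P2a`: infeasible in 0/192 multistarts per class, best margin `0.964` for the cuboctahedron):
  around a ball `b + A q` adjacent to the vacant slot `b + A s₀`, at most SEVEN further balls fit that are `1`-separated, keep distance `≥ 1` from `b` and
  from the other slot balls, and stay `≥ 1/4` away from the vacant slot position.
* `eq_zero_or_eq_of_dist_eq_one_three` — THREE UNIT SPHERES: a point at distance `1` from three linearly independent unit vectors `w₁, w₂, w₃` all adjacent
  to the unit vector `s₀` (`⟪s₀, wᵢ⟫ = ½`) is `0` or `s₀`;
* `quarter_le_dist_vacancy` — THE ¼-HOLE: if three slot neighbours of the vacant slot are saturated, no ball of `X` lies within `1/4` of the vacant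
  position (KissingGap at the three + three unit spheres);
* **`two_unsaturated_of_fccVacancyShell : KissingGap (5/2) → VacancyCapFcc → …`** — if the eleven slots `b + A w`, `w ≠ s₀`, are occupied and
  `b + A s₀` is not, then two distinct slot neighbours of the vacancy have `≤ 11` contacts (so `b`'s pooled deficiency gains two units besides its own).
Tables: `slotNbr` (the four slot neighbours of each slot, kernel-decided on `slotInt`), `slotNbr_det` (any three of them are independent).
WHAT THIS IS NOT: `VacancyCapFcc` is NOT proved (16-dimensional cap packing; numerics only); twin (anticuboctahedral) vacancy shells need the
analogous `VacancyCapTwin` rows (kit j335336: margins 0.950–0.982); nothing here about exotic shells; F-C1 not moved.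
-/

noncomputable section

namespace Summit.Ventures.Crystal3D.Theorems

namespace TailResidue

open Summit.Ventures.Crystal3D Finset NearIdentity
open Literature.Geometry.DiscreteGeometry (eq_zero_of_inner_linearIndependent_fin_three)
open scoped InnerProductSpace

variable {X : Finset (EuclideanSpace ℝ (Fin 3))}

/-! ### The slot-neighbour table -/

/-- The four slot neighbours (`slotInt k ⬝ slotInt l = 1`, i.e. `⟪slot k, slot l⟫ = ½`) of each slot `k`. -/
def slotNbr : Fin 12 → Fin 4 → Fin 12 :=
  ![![4, 5, 8, 9], ![4, 5, 10, 11], ![6, 7, 8, 9], ![6, 7, 10, 11], ![0, 1, 8, 10], ![0, 1, 9, 11], ![2, 3, 8, 10], ![2, 3, 9, 11],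
    ![0, 2, 4, 6], ![0, 2, 5, 7], ![1, 3, 4, 6], ![1, 3, 5, 7]]

/-- Table check: the entries of `slotNbr k` are neighbours of `k`, pairwise distinct, and every neighbour is listed. -/
theorem slotNbr_spec : (∀ k : Fin 12, ∀ i : Fin 4, slotInt k ⬝ᵥ slotInt (slotNbr k i) = 1) ∧
    (∀ k : Fin 12, ∀ i j : Fin 4, slotNbr k i = slotNbr k j → i = j) ∧
    (∀ k l : Fin 12, slotInt k ⬝ᵥ slotInt l = 1 → ∃ i : Fin 4, slotNbr k i = l) := by
  refine ⟨by decide, by decide, by decide⟩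

/-- Any three of the four neighbours of a slot are linearly independent (non-zero integer triple product, omitting the neighbour `o`). -/
theorem slotNbr_det : ∀ k : Fin 12, ∀ o i j l : Fin 4, o ≠ i → o ≠ j → o ≠ l → i ≠ j → i ≠ l → j ≠ l →
    slotInt (slotNbr k i) ⬝ᵥ crossInt (slotInt (slotNbr k j)) (slotInt (slotNbr k l)) ≠ 0 := by
  decide

/-- A neighbour `q` of the slot `k` has exactly three slot neighbours other than `k`. -/
theorem card_slotNbr_other : ∀ k : Fin 12, ∀ i : Fin 4,
    (univ.filter fun l : Fin 12 => l ≠ k ∧ slotInt (slotNbr k i) ⬝ᵥ slotInt l = 1).card = 3 := by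
  decide

/-- A slot is not its own neighbour. -/
theorem slotNbr_ne_self : ∀ k : Fin 12, ∀ i : Fin 4, slotNbr k i ≠ k := by decide

/-- Self products of the integer slots. -/
theorem slotInt_self (k : Fin 12) : slotInt k ⬝ᵥ slotInt k = 2 := by revert k; decide

/-! ### Distances between slot balls -/

/-- `‖A v‖`-bookkeeping: `dist (b + A x) (b + A y) = ‖x − y‖`. -/
theorem dist_add_map (A : EuclideanSpace ℝ (Fin 3) ≃ₗᵢ[ℝ] EuclideanSpace ℝ (Fin 3)) (b x y : EuclideanSpace ℝ (Fin 3)) :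
    dist (b + A x) (b + A y) = ‖x - y‖ := by
  rw [dist_eq_norm, add_sub_add_left_eq_sub, ← map_sub, LinearIsometryEquiv.norm_map]

/-- `‖slot k − slot l‖² = 2 − slotInt k ⬝ slotInt l`. -/
theorem norm_slotSite_sub_sq (k l : Fin 12) : ‖slotSite k - slotSite l‖ ^ 2 = 2 - ((slotInt k ⬝ᵥ slotInt l : ℤ) : ℝ) := by
  rw [← real_inner_self_eq_norm_sq, inner_sub_left, inner_sub_right, inner_sub_right, inner_slotSite, inner_slotSite, inner_slotSite, inner_slotSite,
    slotInt_self, slotInt_self, show slotInt l ⬝ᵥ slotInt k = slotInt k ⬝ᵥ slotInt l from dotProduct_comm _ _]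
  push_cast; ring

/-- Two slot balls `b + A(slot k)`, `b + A(slot l)` are at distance `1` iff `slotInt k ⬝ slotInt l = 1`. -/
theorem dist_slotBall_eq_one_iff (A : EuclideanSpace ℝ (Fin 3) ≃ₗᵢ[ℝ] EuclideanSpace ℝ (Fin 3)) (b : EuclideanSpace ℝ (Fin 3)) (k l : Fin 12) :
    dist (b + A (slotSite k)) (b + A (slotSite l)) = 1 ↔ slotInt k ⬝ᵥ slotInt l = 1 := by
  rw [dist_add_map]
  have h := norm_slotSite_sub_sq k l
  constructor
  · intro h1
    rw [h1, one_pow] at h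
    have : ((slotInt k ⬝ᵥ slotInt l : ℤ) : ℝ) = 1 := by linarith
    exact_mod_cast this
  · intro h1
    rw [h1] at h
    push_cast at h
    have h0 : 0 ≤ ‖slotSite k - slotSite l‖ := norm_nonneg _
    nlinarith

/-- The slot ball `b + A(slot k)` is at distance `1` from `b`. -/
theorem dist_slotBall_center (A : EuclideanSpace ℝ (Fin 3) ≃ₗᵢ[ℝ] EuclideanSpace ℝ (Fin 3)) (b : EuclideanSpace ℝ (Fin 3)) (k : Fin 12) :
    dist b (b + A (slotSite k)) = 1 := by
  rw [dist_comm, dist_eq_norm, add_sub_cancel_left, LinearIsometryEquiv.norm_map, norm_eq_one_of_mem_fccSlots (slotSite_mem k)]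

/-! ### Three unit spheres -/

/-- **THREE UNIT SPHERES.**  If `w₁, w₂, w₃` are linearly independent unit vectors with `⟪s₀, wᵢ⟫ = ½` for a unit vector `s₀`, then a point at distance
`1` from all three is `0` or `s₀` (the two balls touching three mutually adjacent neighbours of a vacancy are the centre and the vacancy itself). -/
theorem eq_zero_or_eq_of_dist_eq_one_three {w : Fin 3 → EuclideanSpace ℝ (Fin 3)} (hind : LinearIndependent ℝ w) (hw : ∀ i, ‖w i‖ = 1)
    {s₀ : EuclideanSpace ℝ (Fin 3)} (hs : ‖s₀‖ = 1) (hsw : ∀ i, ⟪s₀, w i⟫_ℝ = 1 / 2) {x : EuclideanSpace ℝ (Fin 3)} (hx : ∀ i, dist x (w i) = 1) :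
    x = 0 ∨ x = s₀ := by
  set t := ‖x‖ ^ 2 with ht
  have hxw : ∀ i, ⟪x, w i⟫_ℝ = t / 2 := by
    intro i
    have h := hx i
    rw [dist_eq_norm] at h
    have h2 : ‖x - w i‖ ^ 2 = 1 := by rw [h, one_pow]
    rw [← real_inner_self_eq_norm_sq, inner_sub_left, inner_sub_right, inner_sub_right, real_inner_self_eq_norm_sq, real_inner_self_eq_norm_sq, hw i,
      real_inner_comm x (w i)] at h2
    rw [ht]; linarith
  have hz : x - t • s₀ = 0 := by
    refine eq_zero_of_inner_linearIndependent_fin_three hind fun i => ?_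
    rw [inner_sub_left, real_inner_smul_left, hxw i, hsw i]; ring
  have hx' : x = t • s₀ := sub_eq_zero.1 hz
  have htt : t = t ^ 2 := by
    have : ‖x‖ ^ 2 = t ^ 2 := by rw [hx', norm_smul, mul_pow, hs, one_pow, mul_one, Real.norm_eq_abs, sq_abs]
    rw [ht] at this ⊢; exact this
  have ht01 : t = 0 ∨ t = 1 := by
    have : t * (t - 1) = 0 := by nlinarith
    rcases mul_eq_zero.1 this with h | h
    · exact Or.inl h
    · exact Or.inr (by linarith)
  rcases ht01 with h0 | h1
  · left; rw [hx', h0, zero_smul]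
  · right; rw [hx', h1, one_smul]

/-! ### The certificate-shaped input -/

/-- **VACANCY CAP, fcc type (named input, certificate-shaped).**  For a frame `A`, a centre `b`, a slot `s₀ = slot k` (the VACANCY) and a neighbouring
slot `q = slot (slotNbr k i)`: every finite set `N` of balls touching `b + A q`, none of them a slot ball, all at distance `≥ 1` from `b` and from every slot
ball `b + A w` with `w ≠ s₀`, all at distance `≥ 1/4` from the vacant position `b + A s₀`, and pairwise `≥ 1` apart, has at most SEVEN members.
(kit j335336 P2a: eight never fit — 0/192 multistarts for every neighbour class, best minimum distance `0.964`; with the ¼-hole dropped the refill of the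
vacancy is the eighth.)  A 16-dimensional spherical cap-packing statement; to be certified by interval branch-and-bound. -/
def VacancyCapFcc : Prop :=
  ∀ (A : EuclideanSpace ℝ (Fin 3) ≃ₗᵢ[ℝ] EuclideanSpace ℝ (Fin 3)) (b : EuclideanSpace ℝ (Fin 3)) (k : Fin 12) (i : Fin 4)
    (N : Finset (EuclideanSpace ℝ (Fin 3))),
    (∀ x ∈ N, dist x (b + A (slotSite (slotNbr k i))) = 1) →
    (∀ x ∈ N, ∀ l : Fin 12, x ≠ b + A (slotSite l)) →
    (∀ x ∈ N, 1 ≤ dist x b) →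
    (∀ x ∈ N, ∀ l : Fin 12, l ≠ k → 1 ≤ dist x (b + A (slotSite l))) →
    (∀ x ∈ N, 1 / 4 ≤ dist x (b + A (slotSite k))) →
    (∀ x ∈ N, ∀ y ∈ N, x ≠ y → 1 ≤ dist x y) →
    N.card ≤ 7

/-! ### The ¼-hole -/

open scoped Classical in
/-- **THE ¼-HOLE.**  Under GAP(5/2): if the slot ball at the vacancy `b + A(slot k)` is absent and three distinct slot neighbours of the vacancy are
saturated, then every ball of `X` is at distance `≥ 1/4` from the vacant position. -/
theorem quarter_le_dist_vacancy (hg : KissingGap (5 / 2)) (hX : ∀ p ∈ X, ∀ q ∈ X, p ≠ q → 1 ≤ dist p q)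
    (A : EuclideanSpace ℝ (Fin 3) ≃ₗᵢ[ℝ] EuclideanSpace ℝ (Fin 3)) (b : EuclideanSpace ℝ (Fin 3)) {k : Fin 12}
    (hvac : b + A (slotSite k) ∉ X) {i j l : Fin 4} (hij : i ≠ j) (hil : i ≠ l) (hjl : j ≠ l) (ho : ∃ o : Fin 4, o ≠ i ∧ o ≠ j ∧ o ≠ l)
    (hsat : ∀ m ∈ ({i, j, l} : Finset (Fin 4)), b + A (slotSite (slotNbr k m)) ∈ X ∧
      (X.filter fun q => dist (b + A (slotSite (slotNbr k m))) q = 1).card = 12)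
    {x : EuclideanSpace ℝ (Fin 3)} (hx : x ∈ X) : 1 / 4 ≤ dist x (b + A (slotSite k)) := by
  by_contra hlt
  push Not at hlt
  -- each of the three saturated neighbours is at distance exactly 1 from x
  have hone : ∀ m ∈ ({i, j, l} : Finset (Fin 4)), dist (b + A (slotSite (slotNbr k m))) x = 1 := by
    intro m hm
    obtain ⟨hmX, h12⟩ := hsat m hm
    have hadj : dist (b + A (slotSite k)) (b + A (slotSite (slotNbr k m))) = 1 :=
      (dist_slotBall_eq_one_iff A b k (slotNbr k m)).2 (slotNbr_spec.1 k m)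
    rcases eq_or_dist_eq_one_or_le_dist_of_saturated hg hX hmX h12 hx with h | h | h
    · -- `x` is the neighbour itself: distance 1 from the vacancy, not `< 1/4`
      rw [h, dist_comm] at hlt; rw [hadj] at hlt; norm_num at hlt
    · exact h
    · have htri := dist_triangle (b + A (slotSite (slotNbr k m))) (b + A (slotSite k)) x
      rw [dist_comm (b + A (slotSite (slotNbr k m))) (b + A (slotSite k)), hadj] at htri
      rw [dist_comm] at hlt
      linarith
  -- translate to the origin: `x − b` is at distance 1 from the three unit vectors `A(slot ·)`
  obtain ⟨o, hoi, hoj, hol⟩ := ho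
  let idx : Fin 3 → Fin 4 := ![i, j, l]
  have hidx : ∀ m, idx m ∈ ({i, j, l} : Finset (Fin 4)) := by intro m; fin_cases m <;> simp [idx]
  let w : Fin 3 → EuclideanSpace ℝ (Fin 3) := fun m => A (slotSite (slotNbr k (idx m)))
  have hind0 : LinearIndependent ℝ ![slotSite (slotNbr k i), slotSite (slotNbr k j), slotSite (slotNbr k l)] :=
    linearIndependent_slotSite (slotNbr_det k o i j l hoi hoj hol hij hil hjl)
  have hind : LinearIndependent ℝ w := by
    have h := hind0.map' A.toLinearEquiv.toLinearMap (LinearMap.ker_eq_bot.2 A.toLinearEquiv.injective)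
    have e : w = (A.toLinearEquiv.toLinearMap : EuclideanSpace ℝ (Fin 3) →ₗ[ℝ] EuclideanSpace ℝ (Fin 3)) ∘
        ![slotSite (slotNbr k i), slotSite (slotNbr k j), slotSite (slotNbr k l)] := by
      funext m; fin_cases m <;> rfl
    rw [e]; exact h
  have hwn : ∀ m, ‖w m‖ = 1 := fun m => by
    show ‖A (slotSite (slotNbr k (idx m)))‖ = 1
    rw [LinearIsometryEquiv.norm_map, norm_eq_one_of_mem_fccSlots (slotSite_mem _)]
  have hs0 : ‖A (slotSite k)‖ = 1 := by rw [LinearIsometryEquiv.norm_map, norm_eq_one_of_mem_fccSlots (slotSite_mem k)]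
  have hsw : ∀ m, ⟪A (slotSite k), w m⟫_ℝ = 1 / 2 := fun m => by
    show ⟪A (slotSite k), A (slotSite (slotNbr k (idx m)))⟫_ℝ = 1 / 2
    rw [LinearIsometryEquiv.inner_map_map, inner_slotSite, slotNbr_spec.1 k (idx m)]; norm_num
  have hxw : ∀ m, dist (x - b) (w m) = 1 := fun m => by
    show dist (x - b) (A (slotSite (slotNbr k (idx m)))) = 1
    have e : ∀ v : EuclideanSpace ℝ (Fin 3), dist (x - b) v = dist (b + v) x := fun v => by
      rw [dist_eq_norm, dist_eq_norm, ← norm_neg (b + v - x)]; congr 1; abel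
    rw [e]; exact hone (idx m) (hidx m)
  rcases eq_zero_or_eq_of_dist_eq_one_three hind hwn hs0 hsw hxw with h0 | h1
  · -- `x = b`: distance 1 from the vacancy
    have hxb : x = b := by rwa [sub_eq_zero] at h0
    rw [hxb, dist_slotBall_center] at hlt; norm_num at hlt
  · -- `x = b + A s₀`: the vacancy would be occupied
    have hxv : x = b + A (slotSite k) := by rw [← h1]; abel
    exact hvac (hxv ▸ hx)

/-! ### The vacancy census -/

open scoped Classical in
/-- **VACANCY CENSUS (fcc type).**  Under GAP(5/2) and `VacancyCapFcc`: if the eleven slot balls `b + A(slot l)`, `l ≠ k`, of a ball `b ∈ X` are present and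
the slot ball `b + A(slot k)` is absent, then two distinct neighbours of `b` (slot neighbours of the vacancy) have at most eleven contacts each. -/
theorem two_unsaturated_of_fccVacancyShell (hg : KissingGap (5 / 2)) (hcap : VacancyCapFcc) (hX : ∀ p ∈ X, ∀ q ∈ X, p ≠ q → 1 ≤ dist p q)
    (A : EuclideanSpace ℝ (Fin 3) ≃ₗᵢ[ℝ] EuclideanSpace ℝ (Fin 3)) {b : EuclideanSpace ℝ (Fin 3)} (hb : b ∈ X) {k : Fin 12}
    (hocc : ∀ l : Fin 12, l ≠ k → b + A (slotSite l) ∈ X) (hvac : b + A (slotSite k) ∉ X) :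
    ∃ y ∈ X, ∃ y' ∈ X, y ≠ y' ∧ dist b y = 1 ∧ dist b y' = 1 ∧
      (X.filter fun q => dist y q = 1).card ≤ 11 ∧ (X.filter fun q => dist y' q = 1).card ≤ 11 := by
  -- the four neighbours of the vacancy
  set n : Fin 4 → EuclideanSpace ℝ (Fin 3) := fun i => b + A (slotSite (slotNbr k i)) with hn
  have hnX : ∀ i, n i ∈ X := fun i => hocc _ (slotNbr_ne_self k i)
  have hnb : ∀ i, dist b (n i) = 1 := fun i => dist_slotBall_center A b _
  have hninj : ∀ i j, n i = n j → i = j := by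
    intro i j h
    have h1 : slotSite (slotNbr k i) = slotSite (slotNbr k j) := A.injective (add_left_cancel h)
    exact slotNbr_spec.2.1 k i j (slotSite_injective h1)
  have hle : ∀ i, (X.filter fun q => dist (n i) q = 1).card ≤ 12 := fun i => card_filter_dist_eq_one_le_twelve X hX _
  by_contra H
  push Not at H
  -- at most one of the four is unsaturated
  have huniq : ∀ i j, (X.filter fun q => dist (n i) q = 1).card ≤ 11 → (X.filter fun q => dist (n j) q = 1).card ≤ 11 → i = j := by
    intro i j hi hj
    by_contra hij
    have hne : n i ≠ n j := fun h => hij (hninj i j h)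
    have := H (n i) (hnX i) (n j) (hnX j) hne (hnb i) (hnb j) hi
    omega
  -- choose `o` carrying the possible exception; the other three are saturated
  obtain ⟨o, ho⟩ : ∃ o : Fin 4, ∀ m, m ≠ o → (X.filter fun q => dist (n m) q = 1).card = 12 := by
    by_cases hex : ∃ o : Fin 4, (X.filter fun q => dist (n o) q = 1).card ≤ 11
    · obtain ⟨o, ho⟩ := hex
      refine ⟨o, fun m hm => ?_⟩
      have h1 := hle m
      by_contra hne
      exact hm (huniq m o (by omega) ho)
    · push Not at hex
      exact ⟨0, fun m _ => le_antisymm (hle m) (by have := hex m; omega)⟩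
  set i := o.succAbove 0 with hi
  set j := o.succAbove 1 with hj
  set l := o.succAbove 2 with hl
  have hij : i ≠ j := fun h => by have := Fin.succAbove_right_injective (p := o) h; exact absurd this (by decide)
  have hil : i ≠ l := fun h => by have := Fin.succAbove_right_injective (p := o) h; exact absurd this (by decide)
  have hjl : j ≠ l := fun h => by have := Fin.succAbove_right_injective (p := o) h; exact absurd this (by decide)
  have hoi : o ≠ i := (Fin.succAbove_ne o 0).symm
  have hoj : o ≠ j := (Fin.succAbove_ne o 1).symm
  have hol : o ≠ l := (Fin.succAbove_ne o 2).symm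
  have hsat : ∀ m ∈ ({i, j, l} : Finset (Fin 4)), b + A (slotSite (slotNbr k m)) ∈ X ∧
      (X.filter fun q => dist (b + A (slotSite (slotNbr k m))) q = 1).card = 12 := by
    intro m hm
    simp only [mem_insert, mem_singleton] at hm
    refine ⟨hnX m, ho m ?_⟩
    rcases hm with rfl | rfl | rfl
    · exact hoi.symm
    · exact hoj.symm
    · exact hol.symm
  have hole : ∀ x ∈ X, 1 / 4 ≤ dist x (b + A (slotSite k)) := fun x hx =>
    quarter_le_dist_vacancy hg hX A b hvac hij hil hjl ⟨o, hoi, hoj, hol⟩ hsat hx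
  -- the saturated neighbour `n i` and its contacts
  have hi12 : (X.filter fun q => dist (n i) q = 1).card = 12 := ho i hoi.symm
  set C := X.filter fun q => dist (n i) q = 1 with hC
  set Fp : Finset (EuclideanSpace ℝ (Fin 3)) :=
    insert b ((univ.filter fun m : Fin 12 => m ≠ k ∧ slotInt (slotNbr k i) ⬝ᵥ slotInt m = 1).image fun m => b + A (slotSite m)) with hFp
  have hslot_inj : Function.Injective fun m : Fin 12 => b + A (slotSite m) := by
    intro m m' h
    exact slotSite_injective (A.injective (add_left_cancel h))
  have hb_notin : b ∉ (univ.filter fun m : Fin 12 => m ≠ k ∧ slotInt (slotNbr k i) ⬝ᵥ slotInt m = 1).image fun m => b + A (slotSite m) := by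
    intro hmem
    obtain ⟨m, -, hm⟩ := mem_image.1 hmem
    have h1 := dist_slotBall_center A b m
    rw [hm, dist_self] at h1
    exact zero_ne_one h1
  have hFcard : Fp.card = 4 := by
    rw [hFp, card_insert_of_notMem hb_notin, card_image_of_injective _ hslot_inj, card_slotNbr_other k i]
  have hFsub : Fp ⊆ C := by
    intro x hx
    rw [hFp, mem_insert] at hx
    rcases hx with rfl | hx
    · exact mem_filter.2 ⟨hb, by rw [dist_comm]; exact hnb i⟩
    · obtain ⟨m, hm, rfl⟩ := mem_image.1 hx
      obtain ⟨hmk, hdot⟩ := (mem_filter.1 hm).2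
      exact mem_filter.2 ⟨hocc m hmk, (dist_slotBall_eq_one_iff A b (slotNbr k i) m).2 hdot⟩
  set N := C \ Fp with hN
  have hNcard : N.card = 8 := by rw [hN, card_sdiff_of_subset hFsub, hi12, hFcard]
  have hNsub : ∀ x ∈ N, x ∈ X ∧ dist (n i) x = 1 ∧ x ∉ Fp := fun x hx => by
    obtain ⟨hxC, hxF⟩ := mem_sdiff.1 hx
    exact ⟨(mem_filter.1 hxC).1, (mem_filter.1 hxC).2, hxF⟩
  -- `N` satisfies the hypotheses of the cap certificate
  have h1 : ∀ x ∈ N, dist x (b + A (slotSite (slotNbr k i))) = 1 := fun x hx => by rw [dist_comm]; exact (hNsub x hx).2.1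
  have h2 : ∀ x ∈ N, ∀ m : Fin 12, x ≠ b + A (slotSite m) := by
    intro x hx m hxm
    obtain ⟨hxX, hxd, hxF⟩ := hNsub x hx
    by_cases hmk : m = k
    · rw [hmk] at hxm; exact hvac (hxm ▸ hxX)
    · have hdot : slotInt (slotNbr k i) ⬝ᵥ slotInt m = 1 := (dist_slotBall_eq_one_iff A b (slotNbr k i) m).1 (hxm ▸ hxd)
      apply hxF
      rw [hFp, mem_insert]
      exact Or.inr (mem_image.2 ⟨m, mem_filter.2 ⟨mem_univ _, hmk, hdot⟩, hxm.symm⟩)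
  have h3 : ∀ x ∈ N, 1 ≤ dist x b := by
    intro x hx
    obtain ⟨hxX, -, hxF⟩ := hNsub x hx
    have hxb : x ≠ b := fun h => hxF (by rw [hFp, h]; exact mem_insert_self _ _)
    exact hX x hxX b hb hxb
  have h4 : ∀ x ∈ N, ∀ m : Fin 12, m ≠ k → 1 ≤ dist x (b + A (slotSite m)) := fun x hx m hmk =>
    hX x (hNsub x hx).1 _ (hocc m hmk) (h2 x hx m)
  have h5 : ∀ x ∈ N, 1 / 4 ≤ dist x (b + A (slotSite k)) := fun x hx => hole x (hNsub x hx).1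
  have h6 : ∀ x ∈ N, ∀ y ∈ N, x ≠ y → 1 ≤ dist x y := fun x hx y hy hxy => hX x (hNsub x hx).1 y (hNsub y hy).1 hxy
  have h7 := hcap A b k i N h1 h2 h3 h4 h5 h6
  omega

/-! ### Two unit spheres and the centre: pinning up to a reflection (appendix, for the free-ball trichotomy of the FULL-reader rows) -/

/-- **TWO UNIT SPHERES AND THE CENTRE.**  If `x` and `p` are unit vectors with `x − p = t • ν` for a unit vector `ν`, then `x = p` or `x = p − 2⟪p, ν⟫ ν` (the
reflection of `p` across the plane `ν^⊥`).  Used with `p` a slot/twin position of `b`'s frame, `ν` the unit normal of the span of two saturated balls adjacent to `p`: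
KissingGap makes a ball near `p` touch both exactly (`inner_sub_eq_zero_of_dist_eq_one_two`), so it sits at `p` or at the reflected position. -/
theorem eq_or_eq_reflect_of_sub_eq_smul {x p ν : EuclideanSpace ℝ (Fin 3)} (hx : ‖x‖ = 1) (hp : ‖p‖ = 1) (hν : ‖ν‖ = 1) {t : ℝ} (ht : x - p = t • ν) :
    x = p ∨ x = p - (2 * ⟪p, ν⟫_ℝ) • ν := by
  have hxp : x = p + t • ν := by rw [← ht]; abel
  have hnn : ⟪ν, ν⟫_ℝ = 1 := by rw [real_inner_self_eq_norm_sq, hν, one_pow]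
  have hpp : ⟪p, p⟫_ℝ = 1 := by rw [real_inner_self_eq_norm_sq, hp, one_pow]
  -- `‖x‖² = ‖p‖² + 2t⟪p,ν⟫ + t²` forces `t (t + 2⟪p,ν⟫) = 0`
  have h1 : ⟪x, x⟫_ℝ = 1 := by rw [real_inner_self_eq_norm_sq, hx, one_pow]
  rw [hxp, inner_add_left, inner_add_right, inner_add_right, real_inner_smul_left, real_inner_smul_left, real_inner_smul_right, real_inner_smul_right, hpp, hnn,
    real_inner_comm p ν] at h1
  have hq : t * (t + 2 * ⟪p, ν⟫_ℝ) = 0 := by nlinarith [h1]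
  rcases mul_eq_zero.1 hq with h0 | h0
  · left; rw [hxp, h0, zero_smul, add_zero]
  · right
    have : t = -(2 * ⟪p, ν⟫_ℝ) := by linarith
    rw [hxp, this, neg_smul]; abel

/-- **Pinning near a position with two saturated neighbours.**  If `x` is a unit vector with `dist x w₁ = dist x w₂ = 1` (`wᵢ` unit) and `⟪p, wᵢ⟫ = ½`, then `x − p`
is orthogonal to `w₁` and to `w₂` (so it is a multiple of any unit normal of their span, and the previous lemma applies). -/
theorem inner_sub_eq_zero_of_dist_eq_one_two {x p w₁ w₂ : EuclideanSpace ℝ (Fin 3)} (hx : ‖x‖ = 1) (hw₁ : ‖w₁‖ = 1) (hw₂ : ‖w₂‖ = 1)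
    (hp₁ : ⟪p, w₁⟫_ℝ = 1 / 2) (hp₂ : ⟪p, w₂⟫_ℝ = 1 / 2) (hx₁ : dist x w₁ = 1) (hx₂ : dist x w₂ = 1) :
    ⟪x - p, w₁⟫_ℝ = 0 ∧ ⟪x - p, w₂⟫_ℝ = 0 := by
  have key : ∀ {w : EuclideanSpace ℝ (Fin 3)}, ‖w‖ = 1 → dist x w = 1 → ⟪x, w⟫_ℝ = 1 / 2 := by
    intro w hw hd
    rw [dist_eq_norm] at hd
    have h2 : ‖x - w‖ ^ 2 = 1 := by rw [hd, one_pow]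
    rw [← real_inner_self_eq_norm_sq, inner_sub_left, inner_sub_right, inner_sub_right, real_inner_self_eq_norm_sq, real_inner_self_eq_norm_sq, hx, hw,
      real_inner_comm x w] at h2
    linarith
  exact ⟨by rw [inner_sub_left, key hw₁ hx₁, hp₁]; ring, by rw [inner_sub_left, key hw₂ hx₂, hp₂]; ring⟩

end TailResidue

end Summit.Ventures.Crystal3D.Theorems

end
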